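import Summits.RiemannHypothesis.RiemannHypothesis.Theorems.TiltedLandingLaw421R3IsoTilt2
import Literature.Analysis.Complex.RoucheTheorem
import Literature.Topology.PlaneTopology.ArgumentIncrement

/-! # RATE CHILD COUNT (A) — quadrant winding lemma + the CHILD COUNT on the Jensen circle (lens-2 g4, stmt-RiemannHypothesis-33346,
RATE residual; module 1/3 of the (CA557) cut of `Cruxes/TiltedLandingLaw421R/Lens2_ChildExists.lean`; ns `RhW08.ChildCount`; by import of tree
`…R3IsoTilt2` (`RhW08.IsolatedTilt.pairQ`) + `Literature` Rouché / argument increment; 0 `sorry`, no instances/notation.)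
§1 ★ `wind_eq_of_quadrants`: a loop through `P → r₁ → Q → r₂ → P` (`P, Q` real `≠ 0`, `r₁, r₂ > 0`) confined quarter by quarter to the closed
half-planes `Im ≤ 0 / ≥ 0 / ≤ 0 / ≥ 0` winds `[P < 0] + [Q < 0]` times.  §2 `pairQ_circle`, ★★ `childCount`: for `G = q·h` (`q = pairQ a b`), `h`
zero-free on the closed Jensen disc with the JENSEN SIGN `Im z·Im(h′/h) ≤ 0` on the circle and no critical point of `G` on it, `G′` has EXACTLY
`1 + [1 + b·(h′/h)(a+b) < 0] + [1 − b·(h′/h)(a−b) < 0]` zeros in the open disc (Rouché divisor count of `G′ = h·2(z − a)·(1 + b cos θ·h′/h)`).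
Nothing here bears on the truth of RH; RH is not proved; 33346/33347 OPEN; checked ≠ proved. -/

noncomputable section

open Complex Metric Set
open scoped Real ComplexConjugate
open Literature.Topology.PlaneTopology
open Literature.Analysis.Complex

namespace RhW08.ChildCount

/-! ## §1 a QUADRANT WINDING LEMMA: a loop through `P → r₁ → Q → r₂ → P` (reals, `r₁, r₂ > 0`) alternating between the closed lower and
upper half-planes winds `[P < 0] + [Q < 0]` times about `0` -/

/-- (K) `log (−I·x) − log (I·x) = ±πI` according to the sign of the non-zero real `x`. -/
theorem log_negI_mul_sub_log_I_mul {x : ℝ} (hx : x ≠ 0) :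
    log (-I * x) - log (I * x) = if x < 0 then (π : ℂ) * I else -((π : ℂ) * I) := by
  rcases lt_or_gt_of_ne hx with h | h
  · have e1 : -I * (x : ℂ) = ((-x : ℝ) : ℂ) * I := by push_cast; ring
    have e2 : I * (x : ℂ) = ((-x : ℝ) : ℂ) * (-I) := by push_cast; ring
    rw [e1, e2, log_ofReal_mul (by linarith) I_ne_zero, log_ofReal_mul (by linarith) (neg_ne_zero.2 I_ne_zero),
      log_I, log_neg_I, if_pos h]
    ring
  · have e1 : -I * (x : ℂ) = ((x : ℝ) : ℂ) * (-I) := by ring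
    have e2 : I * (x : ℂ) = ((x : ℝ) : ℂ) * I := by ring
    rw [e1, e2, log_ofReal_mul h (neg_ne_zero.2 I_ne_zero), log_ofReal_mul h I_ne_zero, log_I, log_neg_I,
      if_neg (not_lt.2 h.le)]
    ring

/-- (K) `I·w` avoids the cut `(−∞, 0]` when `w ≠ 0` lies in the closed lower half-plane. -/
theorem I_mul_mem_slitPlane {w : ℂ} (hw : w ≠ 0) (him : w.im ≤ 0) : I * w ∈ slitPlane := by
  rw [mem_slitPlane_iff]
  have hre : (I * w).re = -w.im := by simp
  have hi : (I * w).im = w.re := by simp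
  rw [hre, hi]
  rcases lt_or_eq_of_le him with h | h
  · left; linarith
  · right
    intro hre0
    exact hw (Complex.ext (by simpa using hre0) (by simpa using h))

/-- (K) `−I·w` avoids the cut `(−∞, 0]` when `w ≠ 0` lies in the closed upper half-plane. -/
theorem negI_mul_mem_slitPlane {w : ℂ} (hw : w ≠ 0) (him : 0 ≤ w.im) : -I * w ∈ slitPlane := by
  rw [mem_slitPlane_iff]
  have hre : (-I * w).re = w.im := by simp
  have hi : (-I * w).im = -w.re := by simp
  rw [hre, hi]
  rcases lt_or_eq_of_le him with h | h
  · left; linarith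
  · right
    intro hre0
    exact hw (Complex.ext (by simpa using hre0) (by simpa using h.symm))

/-- (K) increment of the logarithm of a piece staying in the closed LOWER half-plane minus `0`. -/
theorem logInc_eq_of_im_nonpos {Φ : ℝ → ℂ} (hc : ContinuousOn Φ (Icc 0 1)) (h0 : ∀ t ∈ Icc (0:ℝ) 1, Φ t ≠ 0)
    (him : ∀ t ∈ Icc (0:ℝ) 1, (Φ t).im ≤ 0) : logInc Φ = log (I * Φ 1) - log (I * Φ 0) := by
  have hmem : ∀ t ∈ Icc (0:ℝ) 1, I * Φ t ∈ slitPlane := fun t ht => I_mul_mem_slitPlane (h0 t ht) (him t ht)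
  have hl : ContinuousOn (fun t => log (I * Φ t) + log (-I)) (Icc 0 1) :=
    ((continuousOn_const.mul hc).clog hmem).add continuousOn_const
  rw [logInc_eq hl fun t ht => ?_]
  · ring
  · rw [exp_add, exp_log (slitPlane_ne_zero (hmem t ht)), exp_log (neg_ne_zero.2 I_ne_zero),
      show I * Φ t * -I = -(I * I) * Φ t by ring, I_mul_I]
    ring

/-- (K) increment of the logarithm of a piece staying in the closed UPPER half-plane minus `0`. -/
theorem logInc_eq_of_im_nonneg {Φ : ℝ → ℂ} (hc : ContinuousOn Φ (Icc 0 1)) (h0 : ∀ t ∈ Icc (0:ℝ) 1, Φ t ≠ 0)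
    (him : ∀ t ∈ Icc (0:ℝ) 1, 0 ≤ (Φ t).im) : logInc Φ = log (-I * Φ 1) - log (-I * Φ 0) := by
  have hmem : ∀ t ∈ Icc (0:ℝ) 1, -I * Φ t ∈ slitPlane := fun t ht => negI_mul_mem_slitPlane (h0 t ht) (him t ht)
  have hl : ContinuousOn (fun t => log (-I * Φ t) + log I) (Icc 0 1) :=
    ((continuousOn_const.mul hc).clog hmem).add continuousOn_const
  rw [logInc_eq hl fun t ht => ?_]
  · ring
  · rw [exp_add, exp_log (slitPlane_ne_zero (hmem t ht)), exp_log I_ne_zero,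
      show -I * Φ t * I = -(I * I) * Φ t by ring, I_mul_I]
    ring

/-- (K) ★ **QUADRANT WINDING LEMMA.** A loop `φ` on `[0,1]` in `ℂ \ {0}` with `φ 0 = P`, `φ (1/4) = r₁ > 0`, `φ (1/2) = Q`, `φ (3/4) = r₂ > 0`
all real, staying in the closed lower half-plane on `[0,1/4] ∪ [1/2,3/4]` and in the closed upper half-plane on `[1/4,1/2] ∪ [3/4,1]`, winds
`[P < 0] + [Q < 0]` times about `0`. -/
theorem wind_eq_of_quadrants {φ : ℝ → ℂ} (hc : ContinuousOn φ (Icc 0 1)) (h01 : φ 0 = φ 1)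
    (h0 : ∀ t ∈ Icc (0:ℝ) 1, φ t ≠ 0)
    (hq1 : ∀ t ∈ Icc (0:ℝ) (1/4), (φ t).im ≤ 0) (hq2 : ∀ t ∈ Icc (1/4:ℝ) (1/2), 0 ≤ (φ t).im)
    (hq3 : ∀ t ∈ Icc (1/2:ℝ) (3/4), (φ t).im ≤ 0) (hq4 : ∀ t ∈ Icc (3/4:ℝ) 1, 0 ≤ (φ t).im)
    (hr0 : (φ 0).im = 0) (hr2 : (φ (1/2)).im = 0)
    (hr1 : (φ (1/4)).im = 0) (hp1 : 0 < (φ (1/4)).re) (hr3 : (φ (3/4)).im = 0) (hp3 : 0 < (φ (3/4)).re) :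
    wind φ = (if (φ 0).re < 0 then 1 else 0) + (if (φ (1/2)).re < 0 then 1 else 0) := by
  have hloop : IsNonvanishingLoop φ := ⟨hc, h0, h01⟩
  -- affine pieces
  have piece : ∀ (k : ℝ) (n : ℝ), 0 ≤ k → 0 < n → k + 1 ≤ n →
      ContinuousOn (fun t : ℝ => φ ((t + k) / n)) (Icc 0 1) ∧ (∀ t ∈ Icc (0:ℝ) 1, φ ((t + k) / n) ≠ 0) ∧
      ∀ t ∈ Icc (0:ℝ) 1, (t + k) / n ∈ Icc (k / n) ((k + 1) / n) := by
    intro k n hk hn hkn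
    have hmaps : ∀ t ∈ Icc (0:ℝ) 1, (t + k) / n ∈ Icc (k / n) ((k + 1) / n) := fun t ht =>
      ⟨div_le_div_of_nonneg_right (by linarith [ht.1]) hn.le, div_le_div_of_nonneg_right (by linarith [ht.2]) hn.le⟩
    have hsub : ∀ t ∈ Icc (0:ℝ) 1, (t + k) / n ∈ Icc (0:ℝ) 1 := fun t ht => by
      have h := hmaps t ht
      refine ⟨le_trans (div_nonneg hk hn.le) h.1, le_trans h.2 ?_⟩
      rw [div_le_one hn]; exact hkn
    have hcont : Continuous fun t : ℝ => (t + k) / n := by fun_prop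
    exact ⟨hc.comp hcont.continuousOn hsub, fun t ht => h0 _ (hsub t ht), hmaps⟩
  obtain ⟨c0, n0, m0⟩ := piece 0 4 le_rfl (by norm_num) (by norm_num)
  obtain ⟨c1, n1, m1⟩ := piece 1 4 (by norm_num) (by norm_num) (by norm_num)
  obtain ⟨c2, n2, m2⟩ := piece 2 4 (by norm_num) (by norm_num) (by norm_num)
  obtain ⟨c3, n3, m3⟩ := piece 3 4 (by norm_num) (by norm_num) (by norm_num)
  obtain ⟨ch0, nh0, -⟩ := piece 0 2 le_rfl (by norm_num) (by norm_num)
  obtain ⟨ch1, nh1, -⟩ := piece 1 2 (by norm_num) (by norm_num) (by norm_num)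
  -- the two halvings
  have e := logInc_eq_wind_mul hloop
  rw [logInc_eq_add_halves hloop.hasLogOn] at e
  have hh0 : HasLogOn (fun t : ℝ => φ (t / 2)) (Icc 0 1) := by
    have := hasLogOn_Icc ch0 nh0; simpa using this
  have hh1 : HasLogOn (fun t : ℝ => φ ((t + 1) / 2)) (Icc 0 1) := hasLogOn_Icc ch1 nh1
  rw [logInc_eq_add_halves hh0, logInc_eq_add_halves hh1] at e
  have r0 : logInc (fun t : ℝ => φ (t / 2 / 2)) = logInc (fun t : ℝ => φ ((t + 0) / 4)) :=
    logInc_congr fun t _ => by congr 1; ring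
  have r1 : logInc (fun t : ℝ => φ ((t + 1) / 2 / 2)) = logInc (fun t : ℝ => φ ((t + 1) / 4)) :=
    logInc_congr fun t _ => by congr 1; ring
  have r2 : logInc (fun t : ℝ => φ ((t / 2 + 1) / 2)) = logInc (fun t : ℝ => φ ((t + 2) / 4)) :=
    logInc_congr fun t _ => by congr 1; ring
  have r3 : logInc (fun t : ℝ => φ (((t + 1) / 2 + 1) / 2)) = logInc (fun t : ℝ => φ ((t + 3) / 4)) :=
    logInc_congr fun t _ => by congr 1; ring
  rw [r0, r1, r2, r3] at e
  -- the four quarter increments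
  have q0 := logInc_eq_of_im_nonpos c0 n0 fun t ht => hq1 _ (by have h := m0 t ht; norm_num at h ⊢; exact h)
  have q1 := logInc_eq_of_im_nonneg c1 n1 fun t ht => hq2 _ (by have h := m1 t ht; norm_num at h ⊢; exact h)
  have q2 := logInc_eq_of_im_nonpos c2 n2 fun t ht => hq3 _ (by have h := m2 t ht; norm_num at h ⊢; exact h)
  have q3 := logInc_eq_of_im_nonneg c3 n3 fun t ht => hq4 _ (by have h := m3 t ht; norm_num at h ⊢; exact h)
  rw [q0, q1, q2, q3] at e
  norm_num at e
  rw [← h01] at e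
  -- real values
  have vP : φ 0 = ((φ 0).re : ℂ) := Complex.ext (by rw [ofReal_re]) (by rw [ofReal_im]; exact hr0)
  have vQ : φ (1/2) = ((φ (1/2)).re : ℂ) := Complex.ext (by rw [ofReal_re]) (by rw [ofReal_im]; exact hr2)
  have v1 : φ (1/4) = ((φ (1/4)).re : ℂ) := Complex.ext (by rw [ofReal_re]) (by rw [ofReal_im]; exact hr1)
  have v3 : φ (3/4) = ((φ (3/4)).re : ℂ) := Complex.ext (by rw [ofReal_re]) (by rw [ofReal_im]; exact hr3)
  have hP0 : (φ 0).re ≠ 0 := fun h => h0 0 ⟨le_rfl, zero_le_one⟩ (by rw [vP, h]; simp)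
  have hQ0 : (φ (1/2)).re ≠ 0 := fun h => h0 (1/2) ⟨by norm_num, by norm_num⟩ (by rw [vQ, h]; simp)
  have sP := log_negI_mul_sub_log_I_mul hP0
  have sQ := log_negI_mul_sub_log_I_mul hQ0
  have s1 := log_negI_mul_sub_log_I_mul hp1.ne'
  have s3 := log_negI_mul_sub_log_I_mul hp3.ne'
  rw [if_neg (not_lt.2 hp1.le)] at s1
  rw [if_neg (not_lt.2 hp3.le)] at s3
  rw [← vP] at sP; rw [← vQ] at sQ; rw [← v1] at s1; rw [← v3] at s3
  simp only [neg_mul] at sP sQ s1 s3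
  have key : (wind φ : ℂ) * (2 * π * I) =
      (if (φ 0).re < 0 then (π : ℂ) * I else -((π : ℂ) * I)) + (if (φ (1/2)).re < 0 then (π : ℂ) * I else -((π : ℂ) * I))
        + 2 * π * I := by
    rw [← e, ← sP, ← sQ]; linear_combination -s1 - s3
  apply int_eq_of_mul_two_pi_I_eq
  rw [key]
  split_ifs <;> push_cast <;> ring

/-! ## §2 the CHILD COUNT on the Jensen circle of a removed pair (`G = q·h`, `q = pairQ a b`; on the circle `q = 2b cos θ·(z − a)`, so
`G′ = h·2(z − a)·g`, `g = 1 + b cos θ·(h′/h)` runs `P → 1 → Q → 1 → P` through alternating closed half-planes by the Jensen sign; §1 counts) -/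

open RhW08.IsolatedTilt (pairQ)

/-- (K) the pair factor on its own Jensen circle: `q(a + b e^{iθ}) = 2·(b cos θ)·(b e^{iθ})`. -/
theorem pairQ_circle (a b θ : ℝ) :
    pairQ a b ((a : ℂ) + b * exp (θ * I)) = 2 * ((b * Real.cos θ : ℝ) : ℂ) * (b * exp (θ * I)) := by
  simp only [pairQ, add_sub_cancel_left, exp_mul_I]
  push_cast
  have h := Complex.cos_sq_add_sin_sq (θ : ℂ)
  linear_combination (-(b : ℂ) ^ 2) * h + (b : ℂ) ^ 2 * Complex.sin θ ^ 2 * I_sq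

set_option maxHeartbeats 1600000 in
/-- ★★ (K) **CHILD COUNT ON THE JENSEN CIRCLE.** `G = q·h` on `‖z − a‖ < ρ` (`q = pairQ a b`, `0 < b < ρ`), `h` zero-free on `‖z − a‖ ≤ b`,
Jensen sign `Im z · Im (h′/h)(z) ≤ 0` and `h′/h` real at real points of the circle `‖z − a‖ = b`, and `G′` zero-free on that circle.  Then the
number of zeros of `G′` in the open Jensen disc, counted with multiplicity, is
`1 + [1 + b·Re (h′/h)(a + b) < 0] + [1 − b·Re (h′/h)(a − b) < 0]`. -/
theorem childCount {G h : ℂ → ℂ} {a b ρ : ℝ} (hb : 0 < b) (hbρ : b < ρ)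
    (hGd : DifferentiableOn ℂ G (ball (a : ℂ) ρ)) (hh : DifferentiableOn ℂ h (ball (a : ℂ) ρ))
    (hfac : ∀ z ∈ ball (a : ℂ) ρ, G z = pairQ a b z * h z) (hh0 : ∀ z ∈ closedBall (a : ℂ) b, h z ≠ 0)
    (hsign : ∀ z : ℂ, ‖z - a‖ = b → z.im * (deriv h z / h z).im ≤ 0)
    (hKreal : ∀ x : ℝ, ‖(x : ℂ) - a‖ = b → (deriv h x / h x).im = 0)
    (hcirc : ∀ z : ℂ, ‖z - a‖ = b → deriv G z ≠ 0) :
    ∑ᶠ u, MeromorphicOn.divisor (deriv G) (closedBall (a : ℂ) b) u =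
      1 + (if 1 + b * (deriv h ((a : ℂ) + b) / h ((a : ℂ) + b)).re < 0 then 1 else 0)
        + (if 1 - b * (deriv h ((a : ℂ) - b) / h ((a : ℂ) - b)).re < 0 then 1 else 0) := by
  set γ : ℝ → ℂ := circleLoop (a : ℂ) b with hγ
  set K : ℂ → ℂ := fun z => deriv h z / h z with hK
  set F : ℂ → ℂ := fun z => 2 * (z - a) + pairQ a b z * K z with hF
  set g : ℝ → ℂ := fun t => 1 + ((b * Real.cos (2 * π * t) : ℝ) : ℂ) * K (γ t) with hg
  -- geometry of the Jensen circle
  have hγa : ∀ t : ℝ, γ t - a = b * exp (((2 * π * t : ℝ)) * I) := by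
    intro t; rw [hγ, circleLoop_apply]; push_cast; ring
  have hγe : ∀ t : ℝ, γ t = (a : ℂ) + b * exp (((2 * π * t : ℝ)) * I) := fun t => by rw [← hγa t]; ring
  have hγnorm : ∀ t : ℝ, ‖γ t - a‖ = b := by intro t; rw [hγ, norm_circleLoop_sub_center, abs_of_pos hb]
  have hγball : ∀ t : ℝ, γ t ∈ ball (a : ℂ) ρ := fun t => by rw [mem_ball, dist_eq_norm, hγnorm]; exact hbρ
  have hγcl : ∀ t : ℝ, γ t ∈ closedBall (a : ℂ) b := fun t => by rw [mem_closedBall, dist_eq_norm, hγnorm]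
  have hγim : ∀ t : ℝ, (γ t).im = b * Real.sin (2 * π * t) := by
    intro t
    have := congrArg Complex.im (hγa t)
    rw [sub_im, ofReal_im, sub_zero, im_ofReal_mul, exp_ofReal_mul_I_im] at this
    exact this
  have h01γ : γ 0 = γ 1 := by rw [hγ]; exact circleLoop_zero_eq _ _
  have hγ0 : γ 0 = (((a + b : ℝ)) : ℂ) := by rw [hγe]; push_cast; simp
  have hγhalf : γ (1 / 2) = (((a - b : ℝ)) : ℂ) := by
    rw [hγe, show (((2 * π * (1 / 2 : ℝ) : ℝ)) : ℂ) * I = π * I by push_cast; ring, exp_pi_mul_I]; push_cast; ring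
  -- calculus: `G′ = 2(z − a)h + q h′` on the disc, `= h·F` on the circle, `F = 2(z − a)·g` on the circle
  have hderiv : ∀ z ∈ ball (a : ℂ) ρ, deriv G z = 2 * (z - a) * h z + pairQ a b z * deriv h z := by
    intro z hz
    have hev : G =ᶠ[nhds z] fun w => pairQ a b w * h w :=
      Filter.eventuallyEq_of_mem (isOpen_ball.mem_nhds hz) fun w hw => hfac w hw
    rw [hev.deriv_eq]
    have hq : HasDerivAt (pairQ a b) (2 * (z - a)) z := RhW07.Law421.SuccessorCertificate.hasDerivAt_quadP a b z
    exact (hq.mul ((hh z hz).differentiableAt (isOpen_ball.mem_nhds hz)).hasDerivAt).deriv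
  have hGF : ∀ t : ℝ, deriv G (γ t) = h (γ t) * F (γ t) := by
    intro t
    have hz := hh0 _ (hγcl t)
    rw [hderiv _ (hγball t), hF, hK]
    field_simp
  have hFg : ∀ t : ℝ, F (γ t) = 2 * (γ t - a) * g t := by
    intro t
    have hq : pairQ a b (γ t) = 2 * ((b * Real.cos (2 * π * t) : ℝ) : ℂ) * (b * exp ((2 * π * t : ℝ) * I)) := by
      rw [hγe t]; exact pairQ_circle a b (2 * π * t)
    simp only [hF, hg]
    rw [hq, hγa t]
    ring
  -- regularity
  have hG'd : DifferentiableOn ℂ (deriv G) (ball (a : ℂ) ρ) := (hGd.analyticOnNhd isOpen_ball).deriv.differentiableOn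
  have hh'd : DifferentiableOn ℂ (deriv h) (ball (a : ℂ) ρ) := (hh.analyticOnNhd isOpen_ball).deriv.differentiableOn
  have hKc : ContinuousOn K (closedBall (a : ℂ) b) :=
    (hh'd.continuousOn.mono (closedBall_subset_ball hbρ)).div (hh.continuousOn.mono (closedBall_subset_ball hbρ)) hh0
  have hqc : Continuous (pairQ a b) := by unfold pairQ; fun_prop
  have hFc : ContinuousOn F (closedBall (a : ℂ) b) :=
    ((continuous_const.mul (continuous_id.sub continuous_const)).continuousOn).add (hqc.continuousOn.mul hKc)
  have hγc : Continuous γ := by rw [hγ]; exact continuous_circleLoop _ _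
  have hcosc : Continuous fun t : ℝ => (((b * Real.cos (2 * π * t) : ℝ)) : ℂ) := by fun_prop
  have hgc : ContinuousOn g (Icc 0 1) :=
    (continuousOn_const.add (hcosc.continuousOn.mul (hKc.comp hγc.continuousOn fun t _ => hγcl t)))
  -- non-vanishing on the circle
  have hF0 : ∀ t : ℝ, F (γ t) ≠ 0 := by
    intro t h0
    have := hcirc (γ t) (hγnorm t)
    rw [hGF t, h0, mul_zero] at this
    exact this rfl
  have hγa0 : ∀ t : ℝ, 2 * (γ t - a) ≠ 0 := by
    intro t h0
    have h1 : γ t - a = 0 := by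
      rcases mul_eq_zero.1 h0 with h | h
      · norm_num at h
      · exact h
    have := hγnorm t
    rw [h1, norm_zero] at this
    exact hb.ne' this.symm |>.elim
  have hg0 : ∀ t : ℝ, g t ≠ 0 := by
    intro t h0
    have := hF0 t
    rw [hFg t, h0, mul_zero] at this
    exact this rfl
  -- the loops
  have Lh : IsNonvanishingLoop (fun t => h (γ t)) :=
    ⟨hh.continuousOn.comp hγc.continuousOn fun t _ => hγball t, fun t _ => hh0 _ (hγcl t), by simp only [h01γ]⟩
  have LF : IsNonvanishingLoop (fun t => F (γ t)) :=
    ⟨hFc.comp hγc.continuousOn fun t _ => hγcl t, fun t _ => hF0 t, by simp only [h01γ]⟩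
  have L2 : IsNonvanishingLoop (fun t => 2 * (γ t - a)) :=
    ⟨(continuous_const.mul (hγc.sub continuous_const)).continuousOn, fun t _ => hγa0 t, by simp only [h01γ]⟩
  have g01 : g 0 = g 1 := by
    simp only [hg]; rw [h01γ, mul_zero, mul_one, Real.cos_zero, Real.cos_two_pi]
  have Lg : IsNonvanishingLoop g := ⟨hgc, fun t _ => hg0 t, g01⟩
  -- winding numbers: `G′∘γ`, `h∘γ`, `2(γ − a)`
  have W0 := Rouche.wind_circleLoop_eq_finsum_divisor (deriv G) hb hbρ hG'd fun u hu => hcirc u hu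
  have Wh : wind (fun t => h (γ t)) = 0 := by
    have hsph : ∀ u : ℂ, ‖u - a‖ = b → h u ≠ 0 := fun u hu => hh0 u (by rw [mem_closedBall, dist_eq_norm, hu])
    have := Rouche.wind_circleLoop_eq_finsum_divisor h hb hbρ hh hsph
    rw [hγ, this]
    apply finsum_eq_zero_of_forall_eq_zero
    intro u
    by_contra hne
    obtain ⟨hu, h0⟩ := (Rouche.divisor_ne_zero_iff h hb hbρ hh hsph u).1 hne
    exact hh0 u hu h0
  have W2 : wind (fun t => 2 * (γ t - a)) = 1 := by
    have e : wind (fun t => (fun _ : ℝ => (2 : ℂ)) t * (fun t => γ t - (a : ℂ)) t) =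
        wind (fun _ : ℝ => (2 : ℂ)) + wind (fun t => γ t - (a : ℂ)) :=
      wind_mul (IsNonvanishingLoop.const two_ne_zero) ⟨(hγc.sub continuous_const).continuousOn,
        fun t _ h0 => hγa0 t (by rw [h0, mul_zero]), by simp only [h01γ]⟩
    simp only at e
    rw [e, wind_const, zero_add, hγ]
    exact wind_circleLoop_sub_of_norm_lt (by rw [sub_self, norm_zero]; exact hb)
  -- the sign pattern of `g`
  have him_g : ∀ t : ℝ, (g t).im = b * Real.cos (2 * π * t) * (K (γ t)).im := by
    intro t; simp only [hg, add_im, one_im, im_ofReal_mul, zero_add]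
  have hre_g : ∀ t : ℝ, (g t).re = 1 + b * Real.cos (2 * π * t) * (K (γ t)).re := by
    intro t; simp only [hg, add_re, one_re, re_ofReal_mul]
  have hKsign : ∀ t : ℝ, Real.sin (2 * π * t) * (K (γ t)).im ≤ 0 := by
    intro t
    have h1 := hsign (γ t) (hγnorm t)
    rw [hγim t] at h1
    by_contra hp
    push Not at hp
    have := mul_pos hb hp
    linarith [this, h1, show b * Real.sin (2 * π * t) * (K (γ t)).im = b * (Real.sin (2 * π * t) * (K (γ t)).im) by ring]
  have hKup : ∀ t : ℝ, 0 < t → t < 1 / 2 → (K (γ t)).im ≤ 0 := by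
    intro t h0 h1
    have hs : 0 < Real.sin (2 * π * t) :=
      Real.sin_pos_of_pos_of_lt_pi (by positivity) (by nlinarith [Real.pi_pos])
    have := hKsign t
    by_contra hp; push Not at hp
    have := mul_pos hs hp; linarith
  have hKlow : ∀ t : ℝ, 1 / 2 < t → t < 1 → 0 ≤ (K (γ t)).im := by
    intro t h0 h1
    have hs : Real.sin (2 * π * t) < 0 := by
      rw [← Real.sin_sub_two_pi]
      exact Real.sin_neg_of_neg_of_neg_pi_lt (by nlinarith [Real.pi_pos]) (by nlinarith [Real.pi_pos])
    have := hKsign t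
    by_contra hp; push Not at hp
    have := mul_pos_of_neg_of_neg hs hp; linarith
  have hKreal' : ∀ t : ℝ, (∃ x : ℝ, γ t = (x : ℂ)) → (K (γ t)).im = 0 := by
    rintro t ⟨x, hx⟩
    have hn := hγnorm t
    rw [hx] at hn ⊢
    exact hKreal x hn
  have hK0 : (K (γ 0)).im = 0 := hKreal' 0 ⟨a + b, hγ0⟩
  have hKhalf : (K (γ (1 / 2))).im = 0 := hKreal' (1 / 2) ⟨a - b, hγhalf⟩
  have hK1 : (K (γ 1)).im = 0 := by rw [← h01γ]; exact hK0
  have hq1 : ∀ t ∈ Icc (0:ℝ) (1/4), (g t).im ≤ 0 := by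
    intro t ht
    rw [him_g]
    rcases eq_or_lt_of_le ht.1 with h | h
    · rw [← h, hK0, mul_zero]
    · have hc : 0 ≤ Real.cos (2 * π * t) :=
        Real.cos_nonneg_of_neg_pi_div_two_le_of_le (by nlinarith [Real.pi_pos, ht.1]) (by nlinarith [Real.pi_pos, ht.2])
      exact mul_nonpos_iff.2 (Or.inl ⟨mul_nonneg hb.le hc, hKup t h (by linarith [ht.2])⟩)
  have hq2 : ∀ t ∈ Icc (1/4:ℝ) (1/2), 0 ≤ (g t).im := by
    intro t ht
    rw [him_g]
    rcases eq_or_lt_of_le ht.2 with h | h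
    · rw [h, hKhalf, mul_zero]
    · have hc : Real.cos (2 * π * t) ≤ 0 :=
        Real.cos_nonpos_of_pi_div_two_le_of_le (by nlinarith [Real.pi_pos, ht.1]) (by nlinarith [Real.pi_pos, ht.2])
      exact mul_nonneg_iff.2 (Or.inr ⟨mul_nonpos_iff.2 (Or.inl ⟨hb.le, hc⟩), hKup t (by linarith [ht.1]) h⟩)
  have hq3 : ∀ t ∈ Icc (1/2:ℝ) (3/4), (g t).im ≤ 0 := by
    intro t ht
    rw [him_g]
    rcases eq_or_lt_of_le ht.1 with h | h
    · rw [← h, hKhalf, mul_zero]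
    · have hc : Real.cos (2 * π * t) ≤ 0 :=
        Real.cos_nonpos_of_pi_div_two_le_of_le (by nlinarith [Real.pi_pos, ht.1]) (by nlinarith [Real.pi_pos, ht.2])
      exact mul_nonpos_iff.2 (Or.inr ⟨mul_nonpos_iff.2 (Or.inl ⟨hb.le, hc⟩), hKlow t h (by linarith [ht.2])⟩)
  have hq4 : ∀ t ∈ Icc (3/4:ℝ) 1, 0 ≤ (g t).im := by
    intro t ht
    rw [him_g]
    rcases eq_or_lt_of_le ht.2 with h | h
    · rw [h, hK1, mul_zero]
    · have hc : 0 ≤ Real.cos (2 * π * t) := by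
        rw [← Real.cos_sub_two_pi]
        exact Real.cos_nonneg_of_neg_pi_div_two_le_of_le (by nlinarith [Real.pi_pos, ht.1]) (by nlinarith [Real.pi_pos, ht.2])
      exact mul_nonneg (mul_nonneg hb.le hc) (hKlow t (by linarith [ht.1]) h)
  have hcos1 : Real.cos (2 * π * (1 / 4)) = 0 := by rw [show 2 * π * (1 / 4 : ℝ) = π / 2 by ring]; exact Real.cos_pi_div_two
  have hcos3 : Real.cos (2 * π * (3 / 4)) = 0 := by
    rw [show 2 * π * (3 / 4 : ℝ) = π / 2 + π by ring, Real.cos_add_pi, Real.cos_pi_div_two, neg_zero]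
  have hr0 : (g 0).im = 0 := by rw [him_g, hK0, mul_zero]
  have hr2 : (g (1 / 2)).im = 0 := by rw [him_g, hKhalf, mul_zero]
  have hr1 : (g (1 / 4)).im = 0 := by rw [him_g, hcos1, mul_zero, zero_mul]
  have hr3 : (g (3 / 4)).im = 0 := by rw [him_g, hcos3, mul_zero, zero_mul]
  have hp1 : 0 < (g (1 / 4)).re := by rw [hre_g, hcos1, mul_zero, zero_mul, add_zero]; exact one_pos
  have hp3 : 0 < (g (3 / 4)).re := by rw [hre_g, hcos3, mul_zero, zero_mul, add_zero]; exact one_pos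
  have Wg := wind_eq_of_quadrants hgc g01 (fun t _ => hg0 t) hq1 hq2 hq3 hq4 hr0 hr2 hr1 hp1 hr3 hp3
  have g0re : (g 0).re = 1 + b * (deriv h ((a : ℂ) + b) / h ((a : ℂ) + b)).re := by
    rw [hre_g, mul_zero, Real.cos_zero, mul_one, hγ0]; push_cast; rfl
  have ghre : (g (1 / 2)).re = 1 - b * (deriv h ((a : ℂ) - b) / h ((a : ℂ) - b)).re := by
    rw [hre_g, show 2 * π * (1 / 2 : ℝ) = π by ring, Real.cos_pi, hγhalf]; push_cast; simp only [hK]; ring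
  -- assembly
  calc ∑ᶠ u, MeromorphicOn.divisor (deriv G) (closedBall (a : ℂ) b) u
      = wind (fun t => deriv G (γ t)) := W0.symm
    _ = wind (fun t => h (γ t) * F (γ t)) := congrArg wind (funext hGF)
    _ = wind (fun t => h (γ t)) + wind (fun t => F (γ t)) := wind_mul Lh LF
    _ = wind (fun t => F (γ t)) := by rw [Wh, zero_add]
    _ = wind (fun t => 2 * (γ t - a) * g t) := congrArg wind (funext hFg)
    _ = wind (fun t => 2 * (γ t - a)) + wind g := wind_mul L2 Lg
    _ = 1 + wind g := by rw [W2]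
    _ = _ := by rw [Wg, g0re, ghre]; ring

end RhW08.ChildCount
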